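import Summits.KontsevichZagierPeriods.KontsevichZagierPeriods.Theorems.SoloInformedPathHomotopyPrep
import HarnessLib
import HarnessLib.Audit

/-!
# SoloInformed — the homotopy lemma for logarithmic-derivative representations on `[0,1]`

Solo programme `solo-KontsevichZagierPeriods-informed`, session s112 (kernel project
«`SoloInformedKZPUpTo 1` unconditionally from the tree's kernel Baker theorem»).

**Homotopy lemma** (`soloInformed_pathRep_sub_mem_relations_of_homotopy`).  If `V₀, V₁ ∈ ℚ̄[s]`
have the same end points `V₀(0) = V₁(0)`, `V₀(1) = V₁(1)` and the straight homotopy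
`H(s,t) = (1 − t)V₀(s) + tV₁(s)` does not vanish on `[0,1]²`, then for every `g ∈ ℚ̄`
`[[0,1], Re(g V₁′/V₁)] ≡ [[0,1], Re(g V₀′/V₀)]` modulo `KZ.relations`.

Proof: Green's formula on the square inside the moves (`KZ.of_sub_of_mem_relations_green`) with the
RATIONAL primitives `P = Re(g ∂ₛH/H)`, `Q = Re(g ∂ₜH/H)` of the preparation file — no logarithm is
ever used as a primitive: `∂ₜP = ∂ₛQ = F`; the `t`-edges carry `Q(0,t) = Q(1,t) = 0` because
`H(0,·)`, `H(1,·)` are constant, the `s`-edges carry `Re(g V₁′/V₁) − Re(g V₀′/V₀)`; integrand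
additivity finishes.  Consumers (later files): additivity `Seg(g,a) + Seg(g,b) ≡ Seg(g,ab)` of the
segment generators (`V₁ = L_a · L_b`, `V₀ = L_{ab}`), halving and inversion, and finally the
multiplicative null theorem fed by Baker's theorem.

References: M. Kontsevich, D. Zagier, *Periods* (2001), §1.2, rule (3) («Stokes»).
-/

noncomputable section

open scoped BigOperators Polynomial ComplexConjugate
open MeasureTheory Set Filter
open Literature.ModelTheory.ExponentialFields
open Literature.NumberTheory.Transcendental Literature.NumberTheory.Transcendental.KZ

namespace Summit.KontsevichZagierPeriods.KontsevichZagierPeriods.Theorems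

section Homotopy

variable {g : ℂ} {V₀ V₁ : ℂ[X]}


/-- The `t`-slices of `P`: continuity on `[0,1]` and derivative `F` on `(0,1)`. -/
theorem soloInformed_homP_slice
    (hH : ∀ s ∈ Icc (0 : ℝ) 1, ∀ t ∈ Icc (0 : ℝ) 1,
      (1 - (t : ℂ)) * V₀.eval (s : ℂ) + (t : ℂ) * V₁.eval (s : ℂ) ≠ 0)
    {y : Fin 1 → ℝ} (hy : y ∈ soloInformedUnitBand) :
    ContinuousOn (fun t : ℝ => soloInformedHomP g V₀ V₁ (Fin.snoc y t)) (Icc 0 1) ∧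
      ∀ t ∈ Ioo (0 : ℝ) 1, HasDerivAt (fun t : ℝ => soloInformedHomP g V₀ V₁ (Fin.snoc y t))
        (soloInformedHomF g V₀ V₁ (Fin.snoc y t)) t := by
  set A := V₀.eval ((y 0 : ℝ) : ℂ) with hA
  set B := V₁.eval ((y 0 : ℝ) : ℂ) with hB
  set A' := V₀.derivative.eval ((y 0 : ℝ) : ℂ) with hA'
  set B' := V₁.derivative.eval ((y 0 : ℝ) : ℂ) with hB'
  set hc : ℂ → ℂ := fun τ => (1 - τ) * A + τ * B with hc_def
  set hs : ℂ → ℂ := fun τ => (1 - τ) * A' + τ * B' with hs_def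
  have hz0 : ∀ t : ℝ, (Fin.snoc y t : Fin 2 → ℝ) 0 = y 0 := fun _ => rfl
  have hz1 : ∀ t : ℝ, (Fin.snoc y t : Fin 2 → ℝ) 1 = t := fun _ => rfl
  have hPeq : ∀ t : ℝ, soloInformedHomP g V₀ V₁ (Fin.snoc y t) = (g * (hs t / hc t)).re := by
    intro t
    simp [soloInformedHomP, soloInformedHomS, soloInformedHomC, hc_def, hs_def,
      hz1, Complex.ofReal_sub, hA,
      hB, hA', hB']
  have hc_ne : ∀ t ∈ Icc (0 : ℝ) 1, hc t ≠ 0 := fun t ht => by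
    have := hH (y 0) (soloInformed_mem_unitBand.1 hy) t ht
    simpa [hc_def] using this
  have hc_der : ∀ τ : ℂ, HasDerivAt hc (B - A) τ := fun τ =>
    ((((hasDerivAt_id' τ).const_sub 1).mul_const A).add
      ((hasDerivAt_id' τ).mul_const B)).congr_deriv (by ring)
  have hs_der : ∀ τ : ℂ, HasDerivAt hs (B' - A') τ := fun τ =>
    ((((hasDerivAt_id' τ).const_sub 1).mul_const A').add
      ((hasDerivAt_id' τ).mul_const B')).congr_deriv (by ring)
  have hc_cont : Continuous hc := continuous_iff_continuousAt.2 fun τ => (hc_der τ).continuousAt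
  have hs_cont : Continuous hs := continuous_iff_continuousAt.2 fun τ => (hs_der τ).continuousAt
  refine ⟨?_, fun t ht => ?_⟩
  · have key : ContinuousOn (fun t : ℝ => (g * (hs t / hc t)).re) (Icc 0 1) :=
      Complex.continuous_re.comp_continuousOn (continuousOn_const.mul
        ((hs_cont.comp Complex.continuous_ofReal).continuousOn.div
          (hc_cont.comp Complex.continuous_ofReal).continuousOn hc_ne))
    exact key.congr fun t _ => hPeq t
  · have hne : hc t ≠ 0 := hc_ne t (Ioo_subset_Icc_self ht)
    have hd : HasDerivAt (fun τ => g * (hs τ / hc τ))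
        (g * (((B' - A') * hc t - hs t * (B - A)) / hc t ^ 2)) (t : ℂ) :=
      ((hs_der _).div (hc_der _) hne).const_mul g
    have hF : soloInformedHomF g V₀ V₁ (Fin.snoc y t) =
        (g * (((B' - A') * hc t - hs t * (B - A)) / hc t ^ 2)).re := by
      simp [soloInformedHomF, soloInformedHomST, soloInformedHomS, soloInformedHomT,
        soloInformedHomC, hc_def, hs_def,
        hz1, Complex.ofReal_sub, hA, hB, hA', hB']
    rw [hF]
    exact hd.real_of_complex.congr_of_eventuallyEq (Eventually.of_forall fun t => hPeq t)

/-- The `s`-slices of `Q` at height `t₀ = y 0`: continuity on `[0,1]` and derivative `F` on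
`(0,1)` (the point `(s, t₀)` is `Fin.snoc (Fin.snoc (Fin.init y) s) (y (Fin.last 0))`). -/
theorem soloInformed_homQ_slice
    (hH : ∀ s ∈ Icc (0 : ℝ) 1, ∀ t ∈ Icc (0 : ℝ) 1,
      (1 - (t : ℂ)) * V₀.eval (s : ℂ) + (t : ℂ) * V₁.eval (s : ℂ) ≠ 0)
    {y : Fin 1 → ℝ} (hy : y ∈ soloInformedUnitBand) :
    ContinuousOn (fun s : ℝ => soloInformedHomQ g V₀ V₁
        (Fin.snoc (Fin.snoc (Fin.init y) s : Fin 1 → ℝ) (y (Fin.last 0)))) (Icc 0 1) ∧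
      ∀ s ∈ Ioo (0 : ℝ) 1, HasDerivAt (fun s : ℝ => soloInformedHomQ g V₀ V₁
        (Fin.snoc (Fin.snoc (Fin.init y) s : Fin 1 → ℝ) (y (Fin.last 0))))
        (soloInformedHomF g V₀ V₁ (Fin.snoc (Fin.snoc (Fin.init y) s : Fin 1 → ℝ) (y (Fin.last 0))))
          s := by
  have hpt0 : ∀ s : ℝ, (Fin.snoc (Fin.snoc (Fin.init y) s : Fin 1 → ℝ) (y (Fin.last 0)) :
      Fin 2 → ℝ) 0 = s := fun s => rfl
  have hpt1 : ∀ s : ℝ, (Fin.snoc (Fin.snoc (Fin.init y) s : Fin 1 → ℝ) (y (Fin.last 0)) :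
      Fin 2 → ℝ) 1 = y 0 := fun s => rfl
  set T : ℂ := ((y 0 : ℝ) : ℂ) with hT
  set kc : ℂ → ℂ := fun σ => (1 - T) * V₀.eval σ + T * V₁.eval σ with kc_def
  set kt : ℂ → ℂ := fun σ => V₁.eval σ - V₀.eval σ with kt_def
  have hQeq : ∀ s : ℝ, soloInformedHomQ g V₀ V₁
      (Fin.snoc (Fin.snoc (Fin.init y) s : Fin 1 → ℝ) (y (Fin.last 0))) =
      (g * (kt s / kc s)).re := by
    intro s
    simp only [soloInformedHomQ, soloInformedHomT, soloInformedHomC, hpt0, hpt1, kc_def, kt_def,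
      Complex.ofReal_sub, Complex.ofReal_one, hT]
  have kc_ne : ∀ s ∈ Icc (0 : ℝ) 1, kc s ≠ 0 := fun s hs => by
    have := hH s hs (y 0) (soloInformed_mem_unitBand.1 hy)
    simpa [kc_def, hT] using this
  have kc_der : ∀ σ : ℂ, HasDerivAt kc
      ((1 - T) * V₀.derivative.eval σ + T * V₁.derivative.eval σ) σ := fun σ =>
    ((V₀.hasDerivAt σ).const_mul (1 - T)).add ((V₁.hasDerivAt σ).const_mul T)
  have kt_der : ∀ σ : ℂ, HasDerivAt kt (V₁.derivative.eval σ - V₀.derivative.eval σ) σ := fun σ =>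
    (V₁.hasDerivAt σ).sub (V₀.hasDerivAt σ)
  have kc_cont : Continuous kc := continuous_iff_continuousAt.2 fun σ => (kc_der σ).continuousAt
  have kt_cont : Continuous kt := continuous_iff_continuousAt.2 fun σ => (kt_der σ).continuousAt
  refine ⟨?_, fun s hs => ?_⟩
  · have key : ContinuousOn (fun s : ℝ => (g * (kt s / kc s)).re) (Icc 0 1) :=
      Complex.continuous_re.comp_continuousOn (continuousOn_const.mul
        ((kt_cont.comp Complex.continuous_ofReal).continuousOn.div
          (kc_cont.comp Complex.continuous_ofReal).continuousOn kc_ne))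
    exact key.congr fun s _ => hQeq s
  · have hne : kc s ≠ 0 := kc_ne s (Ioo_subset_Icc_self hs)
    have hd := ((kt_der (s : ℂ)).div (kc_der (s : ℂ)) hne).const_mul g
    have hF : soloInformedHomF g V₀ V₁
        (Fin.snoc (Fin.snoc (Fin.init y) s : Fin 1 → ℝ) (y (Fin.last 0))) =
        (g * (((V₁.derivative.eval (s : ℂ) - V₀.derivative.eval (s : ℂ)) * kc s -
          kt s * ((1 - T) * V₀.derivative.eval (s : ℂ) + T * V₁.derivative.eval (s : ℂ))) /
            kc s ^ 2)).re := by
      simp only [soloInformedHomF, soloInformedHomST, soloInformedHomS, soloInformedHomT,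
        soloInformedHomC, hpt0, hpt1, kc_def, kt_def, Complex.ofReal_sub, Complex.ofReal_one, hT]
      congr 1
      ring
    rw [hF]
    exact hd.real_of_complex.congr_of_eventuallyEq (Eventually.of_forall fun s => hQeq s)

/-- `P` on the top edge `t = 1` is `Re(g V₁′/V₁)`. -/
theorem soloInformed_homP_top (y : Fin 1 → ℝ) :
    soloInformedHomP g V₀ V₁ (Fin.snoc y 1) =
      (g * (V₁.derivative.eval ((y 0 : ℝ) : ℂ) / V₁.eval ((y 0 : ℝ) : ℂ))).re := by
  have hz0 : (Fin.snoc y 1 : Fin 2 → ℝ) 0 = y 0 := rfl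
  have hz1 : (Fin.snoc y 1 : Fin 2 → ℝ) 1 = 1 := rfl
  simp [soloInformedHomP, soloInformedHomS, soloInformedHomC, hz0, hz1]

/-- `P` on the bottom edge `t = 0` is `Re(g V₀′/V₀)`. -/
theorem soloInformed_homP_bot (y : Fin 1 → ℝ) :
    soloInformedHomP g V₀ V₁ (Fin.snoc y 0) =
      (g * (V₀.derivative.eval ((y 0 : ℝ) : ℂ) / V₀.eval ((y 0 : ℝ) : ℂ))).re := by
  have hz0 : (Fin.snoc y 0 : Fin 2 → ℝ) 0 = y 0 := rfl
  have hz1 : (Fin.snoc y 0 : Fin 2 → ℝ) 1 = 0 := rfl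
  simp [soloInformedHomP, soloInformedHomS, soloInformedHomC, hz0, hz1]

/-- `Q` vanishes on the edges `s = 0` and `s = 1` (the two paths share their end points). -/
theorem soloInformed_homQ_edge (h0 : V₀.eval 0 = V₁.eval 0) (h1 : V₀.eval 1 = V₁.eval 1)
    (y : Fin 1 → ℝ) :
    soloInformedHomQ g V₀ V₁ (Fin.snoc (Fin.snoc (Fin.init y) 1 : Fin 1 → ℝ) (y (Fin.last 0))) -
      soloInformedHomQ g V₀ V₁ (Fin.snoc (Fin.snoc (Fin.init y) 0 : Fin 1 → ℝ) (y (Fin.last 0)))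
      = 0 := by
  have hpt0 : ∀ s : ℝ, (Fin.snoc (Fin.snoc (Fin.init y) s : Fin 1 → ℝ) (y (Fin.last 0)) :
      Fin 2 → ℝ) 0 = s := fun s => rfl
  have e1 : soloInformedHomT V₀ V₁
      (Fin.snoc (Fin.snoc (Fin.init y) 1 : Fin 1 → ℝ) (y (Fin.last 0))) = 0 := by
    rw [soloInformedHomT, hpt0]
    simp [h1]
  have e0 : soloInformedHomT V₀ V₁
      (Fin.snoc (Fin.snoc (Fin.init y) 0 : Fin 1 → ℝ) (y (Fin.last 0))) = 0 := by
    rw [soloInformedHomT, hpt0]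
    simp [h0]
  simp only [soloInformedHomQ, e0, e1, zero_div, mul_zero, Complex.zero_re, sub_self]

/-- **Homotopy lemma (H).** For polynomial paths `V₀, V₁ ∈ ℚ̄[s]` with common end points whose
straight homotopy does not vanish on `[0,1]²`, the logarithmic-derivative representations
`[[0,1], Re(g V₁′/V₁)]` and `[[0,1], Re(g V₀′/V₀)]` (`g ∈ ℚ̄`) are equivalent modulo KZ's moves:
Green's formula on the square with the rational primitives `P = Re(g ∂ₛH/H)`, `Q = Re(g ∂ₜH/H)`.
[Kontsevich–Zagier 2001, §1.2, rule (3) «Stokes»; solo-informed s112, design memo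
`kzp1_design_s112.md` §(H)] -/
theorem soloInformed_pathRep_sub_mem_relations_of_homotopy (hg : IsAlgebraic ℚ g)
    (hV₀ : ∀ n, IsAlgebraic ℚ (V₀.coeff n)) (hV₁ : ∀ n, IsAlgebraic ℚ (V₁.coeff n))
    (h0 : V₀.eval 0 = V₁.eval 0) (h1 : V₀.eval 1 = V₁.eval 1)
    (hH : ∀ s ∈ Icc (0 : ℝ) 1, ∀ t ∈ Icc (0 : ℝ) 1,
      (1 - (t : ℂ)) * V₀.eval (s : ℂ) + (t : ℂ) * V₁.eval (s : ℂ) ≠ 0)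
    (R₀ R₁ : IntegralRep 1) (hR₀d : R₀.domain = soloInformedUnitBand)
    (hR₁d : R₁.domain = soloInformedUnitBand)
    (hR₀i : ∀ y ∈ soloInformedUnitBand, R₀.integrand y =
      (g * (V₀.derivative.eval ((y 0 : ℝ) : ℂ) / V₀.eval ((y 0 : ℝ) : ℂ))).re)
    (hR₁i : ∀ y ∈ soloInformedUnitBand, R₁.integrand y =
      (g * (V₁.derivative.eval ((y 0 : ℝ) : ℂ) / V₁.eval ((y 0 : ℝ) : ℂ))).re) :
    of R₁ - of R₀ ∈ relations := by
  -- the exact 2-form `F ds dt` on the square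
  let rP : IntegralRep 2 := ⟨soloInformedUnitSquare, soloInformedHomF g V₀ V₁,
    soloInformed_isSemialgebraic_unitSquare, soloInformed_isSemialgebraicFunOn_homF hg hV₀ hV₁ hH,
    (soloInformed_continuousOn_homF hH).integrableOn_compact soloInformed_isCompact_unitSquare⟩
  -- the `s`-edges: `Re(g V₁′/V₁) − Re(g V₀′/V₀)` on `[0,1]`
  have hsa₁ : IsSemialgebraicFunOn ℚ soloInformedUnitBand R₁.integrand :=
    hR₁d ▸ R₁.isSemialgebraicFunOn_integrand
  have hsa₀ : IsSemialgebraicFunOn ℚ soloInformedUnitBand R₀.integrand :=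
    hR₀d ▸ R₀.isSemialgebraicFunOn_integrand
  have hint₁ : IntegrableOn R₁.integrand soloInformedUnitBand := hR₁d ▸ R₁.integrableOn
  have hint₀ : IntegrableOn R₀.integrand soloInformedUnitBand := hR₀d ▸ R₀.integrableOn
  let bP : IntegralRep 1 := ⟨soloInformedUnitBand, fun y => R₁.integrand y - R₀.integrand y,
    soloInformed_isSemialgebraic_unitBand, IsSemialgebraicFunOn.sub_holds hsa₁ hsa₀,
    hint₁.sub hint₀⟩
  -- the `t`-edges: zero
  let bQ : IntegralRep 1 := ⟨soloInformedUnitBand, fun _ => 0,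
    soloInformed_isSemialgebraic_unitBand, soloInformed_isSemialgebraicFunOn_zero_unitBand,
    integrableOn_zero⟩
  have hPsa : IsSemialgebraicFunOn ℚ rP.domain (soloInformedHomP g V₀ V₁) :=
    (re_im_mul (re_im_const soloInformed_isSemialgebraic_unitSquare
      (isAlgebraic_re_im hg).1 (isAlgebraic_re_im hg).2) (re_im_div (soloInformed_re_im_homS hV₀ hV₁)
      (soloInformed_re_im_homC hV₀ hV₁) fun w hw => soloInformed_homC_ne_zero hH hw)).1
  have hQsa : IsSemialgebraicFunOn ℚ rP.domain (soloInformedHomQ g V₀ V₁) :=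
    (re_im_mul (re_im_const soloInformed_isSemialgebraic_unitSquare
      (isAlgebraic_re_im hg).1 (isAlgebraic_re_im hg).2) (re_im_div (soloInformed_re_im_homT hV₀ hV₁)
      (soloInformed_re_im_homC hV₀ hV₁) fun w hw => soloInformed_homC_ne_zero hH hw)).1
  have hgreen : of bQ - of bP ∈ relations := by
    refine of_sub_of_mem_relations_green (n := 0) (τ := univ) (α := fun _ => 0) (β := fun _ => 1)
      (γ := fun _ => 0) (δ := fun _ => 1) (soloInformedHomP g V₀ V₁) (soloInformedHomQ g V₀ V₁)
      soloInformed_isSemialgebraicFunOn_zero_base soloInformed_isSemialgebraicFunOn_one_base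
      soloInformed_isSemialgebraicFunOn_zero_base soloInformed_isSemialgebraicFunOn_one_base
      (fun _ _ => zero_le_one) (fun _ _ => zero_le_one) rP rP bP bQ rfl rfl hPsa hQsa
      (fun y hy => (soloInformed_homP_slice hH hy).1)
      (fun y hy t ht => (soloInformed_homP_slice hH hy).2 t ht)
      (fun y hy => (soloInformed_homQ_slice hH hy).1)
      (fun y hy s hs => (soloInformed_homQ_slice hH hy).2 s hs)
      (fun _ _ => rfl) rfl (fun y hy => ?_) rfl (fun y _ => ?_)
    · show R₁.integrand y - R₀.integrand y =
        soloInformedHomP g V₀ V₁ (Fin.snoc y 1) - soloInformedHomP g V₀ V₁ (Fin.snoc y 0)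
      rw [soloInformed_homP_top, soloInformed_homP_bot, hR₁i y hy, hR₀i y hy]
    · show (0 : ℝ) = _
      rw [soloInformed_homQ_edge h0 h1]
  have hbQ : of bQ ∈ relations := of_mem_relations_of_eqOn_zero bQ fun _ _ => rfl
  have hbP : of bP ∈ relations := by
    have := relations.sub_mem hbQ hgreen
    simpa using this
  have hadd : of R₁ - of R₀ - of bP ∈ relations :=
    integrandAddRel_subset_relations ⟨1, R₁, R₀, bP, hR₀d.trans hR₁d.symm, hR₁d.symm,
      fun y _ => by simp [bP], rfl⟩
  have := relations.add_mem hadd hbP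
  simpa using this

end Homotopy

end Summit.KontsevichZagierPeriods.KontsevichZagierPeriods.Theorems
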